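import Literature.IUT.LogVolume.GenuineTowerFacts
import HarnessLib

/-!
# The SHARP ramification fact of the tower `F ⊆ K ⊆ F(E[l])` of a genuine Θ-volume datum: `e(u|F) ∣ l` at every
# place `u ∤ l` of `K` ([IUTchIV] Prop. 1.8 (vii) "divides `l`", not merely "prime to `p_u`")

Mochizuki, *Inter-universal Teichmüller theory IV*, RIMS manuscript (Apr. 2020; = PRIMS **57** (2021)), Prop. 1.8
(vii), p. 19: for `E/F` semistable and `K := F(E_F[l])`, "the ramification index of `K/F` at [a place of bad
multiplicative reduction not over `l`] divides `l`" (the Tate-curve description of `E[l]` at a multiplicative place);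
proof of Thm. 1.10, Step (ii), p. 24: "`K` is tamely ramified over [such primes]".

The cell's bundle `Cor22.ThetaVolumeDatumAt.towerFacts` (`GenuineTowerFacts.lean`, abc-iut-S-d1/S3) exports the TAME
form `p_u ∤ e(u|F)` (its `hKbad` component) and the degree form `[K:F] ∣ l(l−1)²(l+1)` (`Gal(K/F) ↪ GL₂(𝔽_l)`), from
which consumers could only bound `e(u|F) ≤ l(l−1)²(l+1)` (abc-iut-c312-7 `Conditional.GenuineK.exists_bad_tame_place_of_ord_neg`).
THIS FILE (proof-only; seat abc-iut-S-d1 gen 8, the R-W window task «HEX-SHARP», HOME/plan/W/WINDOW-SPEC.md §6 (1))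
exports the SHARP form:

* `Cor22.ramificationIdx_dvd_of_ker_le` — GENERIC: `E/F` semistable with `j(E) = j(λ)`, `K ⊆ F(E[l])` Galois over `F`
  (`ker ρ̄_{E,l} ≤ Gal(F̄/ψ(K))`), `l` prime: `e(u|F) ∣ l` at every place `u ∤ l` of `K` — it is a power `l^k`
  (`exists_ramificationIdx_eq_pow_of_ker_le`: `1` over good places of `λ`, a power of `l` over bad ones) dividing
  `[K:F] ∣ l·(l−1)²·(l+1)` (`finrank_dvd_of_ker_le`, `ramificationIdx_dvd_finrank_of_isGalois`), and `l` is coprime to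
  `(l−1)²(l+1)`;
* `Cor22.ThetaVolumeDatumAt.ramificationIdx_dvd_prime` / `…_le_prime` — for EVERY genuine Θ-volume datum `T` at
  `(P, l)` with `λ ∈ U` and every place `u` of `T.K` of residue characteristic `≠ l`: `e(u | T.F) ∣ l` (so `≤ l`).

Consequence used downstream (Summits side): at the bad place over `7` of the `λ_k = 1/2 + 2/7^k` datum,
`e(K_{x₀}/ℚ_7) ≤ 46080·l` instead of `46080·l(l−1)²(l+1)`. Classical; TAKES NO SIDE on [IUTchIII] Cor. 3.12; the IUT
locators are provenance only. [cite: Mochizuki2012, IUTchIV Prop. 1.8 (vii) p.19] [cite: Serre1972, §4.1]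
-/

noncomputable section

open scoped Classical

namespace Literature.IUT.LogVolume

namespace Cor22

open NumberField IsDedekindDomain Literature.NumberTheory.DiophantineGeometry.GenEll
open Literature.NumberTheory.EllipticCurves Literature.NumberTheory.NumberFields Literature.IUT.HodgeTheaters
open WeierstrassCurve IntermediateField Field

/-! ## Arithmetic: a power of a prime `l` dividing `l·(l−1)²·(l+1)` divides `l` -/

/-- For a prime `l`: `l` is coprime to `(l−1)²·(l+1)`. [folklore] -/
private theorem prime_coprime_pred_sq_mul_succ {l : ℕ} (hl : l.Prime) : Nat.Coprime l ((l - 1) ^ 2 * (l + 1)) := by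
  have h2 : 2 ≤ l := hl.two_le
  have hpred : Nat.Coprime l (l - 1) := by
    have h : Nat.Coprime (l - 1 + 1) (l - 1) := by
      rw [Nat.coprime_self_add_left]
      exact Nat.coprime_one_left _
    rwa [Nat.sub_add_cancel (by omega : 1 ≤ l)] at h
  have hsucc : Nat.Coprime l (l + 1) := by
    rw [Nat.coprime_self_add_right]
    exact Nat.coprime_one_right _
  exact Nat.Coprime.mul_right (Nat.Coprime.pow_right 2 hpred) hsucc

/-- For a prime `l`: if `l^k ∣ l·(l−1)²·(l+1)` then `l^k ∣ l` (so `k ≤ 1`). [folklore] -/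
private theorem prime_pow_dvd_of_dvd_card {l k : ℕ} (hl : l.Prime) (h : l ^ k ∣ l * (l - 1) ^ 2 * (l + 1)) :
    l ^ k ∣ l := by
  have hcop : Nat.Coprime (l ^ k) ((l - 1) ^ 2 * (l + 1)) :=
    Nat.Coprime.pow_left k (prime_coprime_pred_sq_mul_succ hl)
  rw [mul_assoc] at h
  exact hcop.dvd_of_dvd_mul_right h

/-! ## Generic: `K ⊆ F(E[l])` over a semistable `E/F` with `j(E) = j(λ)` -/

section GenericCurve

variable {P : NFPoint} {F : Type} [Field F] [NumberField F] [Algebra P.F F] {E : WeierstrassCurve F}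
  [hE : E.IsElliptic]
variable {K : Type} [Field K] [NumberField K] [Algebra F K] (ψ : K →ₐ[F] AlgebraicClosure F)

/-- **`e(u|F) ∣ l` at every place `u ∤ l`** for `K ⊆ F(E[l])` Galois over `F`, `E/F` semistable with `j(E) = j(λ)`,
`l` prime ([IUTchIV] Prop. 1.8 (vii): `e = 1` over the good places of `λ`, `e ∣ l` over the bad ones — here from
`e = l^k` and `e ∣ [K:F] ∣ #GL₂(𝔽_l) = l(l−1)²(l+1)`). [cite: Mochizuki2012, IUTchIV Prop. 1.8 (vii) p.19]
[cite: Serre1972, §4.1] -/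
theorem ramificationIdx_dvd_of_ker_le (hss : E.IsSemistable (𝓞 F)) (hj : E.j = algebraMap P.F F (jInv P.x))
    [IsGalois F K] {l : ℕ} (hl : l.Prime) (hK : (E.galoisRepTorsion (l : ℤ)).ker ≤ ψ.fieldRange.fixingSubgroup)
    (u : HeightOneSpectrum (𝓞 K)) (hlu : ((l : ℕ) : 𝓞 F) ∉ (finBelow F K u).asIdeal) :
    u.asIdeal.ramificationIdx (𝓞 F) ∣ l := by
  haveI : Fact l.Prime := ⟨hl⟩
  obtain ⟨k, hk⟩ := exists_ramificationIdx_eq_pow_of_ker_le ψ hss hj hl hK u hlu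
  have hdeg : Module.finrank F K ∣ l * (l - 1) ^ 2 * (l + 1) := finrank_dvd_of_ker_le ψ hK
  haveI : (finBelow F K u).asIdeal.IsMaximal := (finBelow F K u).isMaximal
  have hdvd : u.asIdeal.ramificationIdx (𝓞 F) ∣ Module.finrank F K :=
    ramificationIdx_dvd_finrank_of_isGalois (F := F) (E := K) (finBelow F K u).asIdeal u.asIdeal
  rw [hk] at hdvd ⊢
  exact prime_pow_dvd_of_dvd_card hl (hdvd.trans hdeg)

/-- The same as an inequality: `e(u|F) ≤ l`. [cite: Mochizuki2012, IUTchIV Prop. 1.8 (vii) p.19] -/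
theorem ramificationIdx_le_of_ker_le (hss : E.IsSemistable (𝓞 F)) (hj : E.j = algebraMap P.F F (jInv P.x))
    [IsGalois F K] {l : ℕ} (hl : l.Prime) (hK : (E.galoisRepTorsion (l : ℤ)).ker ≤ ψ.fieldRange.fixingSubgroup)
    (u : HeightOneSpectrum (𝓞 K)) (hlu : ((l : ℕ) : 𝓞 F) ∉ (finBelow F K u).asIdeal) :
    u.asIdeal.ramificationIdx (𝓞 F) ≤ l :=
  Nat.le_of_dvd hl.pos (ramificationIdx_dvd_of_ker_le ψ hss hj hl hK u hlu)

end GenericCurve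

/-! ## The genuine Θ-volume datum -/

namespace ThetaVolumeDatumAt

variable {P : NFPoint} {l : ℕ} (T : ThetaVolumeDatumAt P l)

/-- **`e(u | F) ∣ l` at every place `u` of `K` of residue characteristic `≠ l`**, for every genuine Θ-volume datum
`T` at `(P, l)` (`λ ∈ U`): the SHARP companion of the `hKbad`/`hKgood` components of `towerFacts` (which give
`p_u ∤ e` at bad places and `e = 1` at good ones). [cite: Mochizuki2012, IUTchIV Prop. 1.8 (vii) p.19] -/
theorem ramificationIdx_dvd_prime :
    (letI := T.instFieldF; letI := T.instNumberFieldF; letI := T.instAlgebraF; letI := T.instFieldK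
     letI := T.instNumberFieldK; letI := T.instAlgebraK; letI := T.instFieldFbar; letI := T.instAlgebraFbar
     letI := T.instAlgebraKFbar; letI := T.instIsElliptic
     ∀ u : HeightOneSpectrum (𝓞 T.K), residueChar T.K u ≠ l → u.asIdeal.ramificationIdx (𝓞 T.F) ∣ l) := by
  letI := T.instFieldF; letI := T.instNumberFieldF; letI := T.instAlgebraF; letI := T.instFieldK
  letI := T.instNumberFieldK; letI := T.instAlgebraK; letI := T.instFieldFbar; letI := T.instAlgebraFbar
  letI := T.instAlgebraKFbar; letI := T.instIsElliptic
  intro u hu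
  have hl : l.Prime := T.D.l_prime
  haveI : Fact l.Prime := ⟨hl⟩
  haveI := T.D.isScalarTower
  haveI := T.D.isAlgClosure
  haveI : IsGalois T.F T.K := isGalois_F_K_of_initialThetaData T.D
  -- the embedding `K → AlgebraicClosure F` inside the `l`-division field, as in `towerFacts`
  let ι : T.Fbar ≃ₐ[T.F] AlgebraicClosure T.F := IsAlgClosure.equiv T.F T.Fbar (AlgebraicClosure T.F)
  let ψ : T.K →ₐ[T.F] AlgebraicClosure T.F :=
    (ι : T.Fbar →ₐ[T.F] AlgebraicClosure T.F).comp (IsScalarTower.toAlgHom T.F T.K T.Fbar)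
  have hK : (T.E.galoisRepTorsion (l : ℤ)).ker ≤ ψ.fieldRange.fixingSubgroup :=
    ker_galoisRepTorsion_le_fixingSubgroup_of_initialThetaData T.D ι
  exact ramificationIdx_dvd_of_ker_le ψ T.D.isSemistable T.j_eq hl hK u
    (natCast_notMem_finBelow_of_residueChar_ne hl u hu)

/-- The same as an inequality: `e(u | F) ≤ l`. [cite: Mochizuki2012, IUTchIV Prop. 1.8 (vii) p.19] -/
theorem ramificationIdx_le_prime :
    (letI := T.instFieldF; letI := T.instNumberFieldF; letI := T.instAlgebraF; letI := T.instFieldK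
     letI := T.instNumberFieldK; letI := T.instAlgebraK; letI := T.instFieldFbar; letI := T.instAlgebraFbar
     letI := T.instAlgebraKFbar; letI := T.instIsElliptic
     ∀ u : HeightOneSpectrum (𝓞 T.K), residueChar T.K u ≠ l → u.asIdeal.ramificationIdx (𝓞 T.F) ≤ l) := by
  letI := T.instFieldF; letI := T.instNumberFieldF; letI := T.instAlgebraF; letI := T.instFieldK
  letI := T.instNumberFieldK; letI := T.instAlgebraK; letI := T.instFieldFbar; letI := T.instAlgebraFbar
  letI := T.instAlgebraKFbar; letI := T.instIsElliptic
  intro u hu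
  exact Nat.le_of_dvd T.D.l_prime.pos (T.ramificationIdx_dvd_prime u hu)

end ThetaVolumeDatumAt

end Cor22

end Literature.IUT.LogVolume

end
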